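import Mathlib.Tactic.Group
import Literature.AnabelianGeometry.SemiGraphs.ArithTemperedGroupOfOuterAction
import HarnessLib

/-!
# [SemiAnbd] Thm 5.4, producer row T54-B: vertex and edge CONJUGATORS for the outer semi-direct product
# model (the `exists_isVConj` / `exists_isEConj`-clause-1 inputs of the arithmetic tower, unfolded)

Mochizuki, *Semi-graphs of anabelioids*, Publ. RIMS **42** (2006), §5 p. 65 ll. 4–14 ("decomposition
groups `Π^temp_{𝔊,v} ⊆ Π^temp_𝔊` … well-defined up to conjugation"), Thm 5.4 p. 66
[cite: MochizukiSemiAnbd2006, §5, p. 65].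

PROOF-ONLY sequel (no definitions) of `ArithTemperedGroupOfOuterAction.lean` (p416276).  abc-iut-L3-d4's
arithmetic tower (`SubgroupPresentationArithCompat.lean`, T54-B-tower T1b) acts on the coset graphs of a
subgroup presentation `(H_w, M_ε, s_b)` of `𝔾` in `Γ = π₁^temp(𝒢)` under `IsArithCompatible`, whose two
existence fields are, for `Φ : E →* Aut Γ`, `σ : E →* Aut 𝔾`:
`exists_isVConj : ∀ e w, ∃ k, ∀ x, x ∈ H_w ↔ k⁻¹ Φe(x) k ∈ H_{σe w}` (an EXACT conjugacy
`Φe(H_w) = k H_{σe w} k⁻¹`) and the first clause of `exists_isEConj` (`Φe(M_ε) ≤ m M_{σe ε} m⁻¹`).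
For `E := π₁^temp(𝒢) ⋊^out_ρ Π_A` with `Φ e :=` the `Aut`-component of `e` and `σ := baseAct ∘ aug`,
and representatives `H_w ∈ verticialSubgroups c w`, `M_ε ∈ edgeLikeSubgroups c ε`, these are
THEOREMS from the chart-action binders `hV` / `hE` of the parent file together with "one conjugacy class
of verticial (edge-like) subgroups per vertex (edge)" (abc-iut-L3-t11
`exists_conj_of_mem_verticialSubgroups` / `exists_conj_of_mem_edgeLikeSubgroups`) — here stated
UNFOLDED (T1b's `IsVConj`/`IsEConj` are not yet in the tree), for the packager (abc-iut-w4-d053) to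
cite by name.  No side taken on [IUTchIII] Cor 3.12; typed ≠ proved.
-/

namespace Literature.AnabelianGeometry.SemiGraphs

open Literature.AnabelianGeometry.EtaleTheta
open CategoryTheory

universe u w

namespace ProfiniteSemiGraph

variable {𝒢 : ProfiniteSemiGraph.{u}} (c : TemperedPiChart 𝒢)
  {PA : Type w} [Group PA] (ρ : PA →* TopOut c.G) (baseAct : PA →* Aut 𝒢.graph)

/-- An exact conjugacy `Φ(H) = g H' g⁻¹` for a bijective `Φ` gives the two-sided membership
dictionary `x ∈ H ↔ g⁻¹ Φ(x) g ∈ H'`. [folklore] -/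
private theorem mem_iff_of_map_eq_conj {G : Type*} [Group G] (Φ : MulAut G) (H H' : Subgroup G)
    (g : G) (h : H.map Φ.toMonoidHom = H'.map (MulAut.conj g).toMonoidHom) (x : G) :
    x ∈ H ↔ g⁻¹ * Φ x * g ∈ H' := by
  constructor
  · intro hx
    have : Φ x ∈ H'.map (MulAut.conj g).toMonoidHom := by
      rw [← h]; exact ⟨x, hx, rfl⟩
    obtain ⟨y, hy, hyx⟩ := this
    simp only [MulEquiv.coe_toMonoidHom, MulAut.conj_apply] at hyx
    rw [← hyx]
    simpa [mul_assoc] using hy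
  · intro hx
    have : Φ x ∈ H.map Φ.toMonoidHom := by
      rw [h]
      refine ⟨g⁻¹ * Φ x * g, hx, ?_⟩
      simp only [MulEquiv.coe_toMonoidHom, MulAut.conj_apply]
      group
    obtain ⟨y, hy, hyx⟩ := this
    simp only [MulEquiv.coe_toMonoidHom] at hyx
    rwa [← Φ.injective hyx]

/-- **Vertex conjugators exist** (T1b `exists_isVConj`, unfolded) for `Π^temp_𝔊 := π₁^temp(𝒢) ⋊^out Π_A`:
for every `e` and every vertex `w`, with `H_w ∈ verticialSubgroups c w` chosen representatives, there is
`k ∈ π₁^temp(𝒢)` with `x ∈ H_w ↔ k⁻¹ · φ_e(x) · k ∈ H_{(aug e)•w}` (`φ_e` = the `Aut`-component of `e`),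
from the binder `hV` and "one conjugacy class per vertex". [cite: MochizukiSemiAnbd2006, §5, p. 65] -/
theorem exists_vConj_outerAction
    (hV : ∀ (a : PA) (v : 𝒢.graph.Vertex) (H : Subgroup c.G), H ∈ verticialSubgroups c v →
      ∃ φ : contMulAut c.G, TopOut.mk c.G φ = ρ a ∧
        H.map (φ : MulAut c.G).toMonoidHom ∈ verticialSubgroups c ((baseAct a).hom.vertexMap v))
    (Hv : 𝒢.graph.Vertex → Subgroup c.G) (hHv : ∀ w, Hv w ∈ verticialSubgroups c w)
    (e : outerSemidirectProduct ρ) (w : 𝒢.graph.Vertex) :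
    ∃ k : c.G, ∀ x : c.G, x ∈ Hv w ↔
      k⁻¹ * (e.1.1 : MulAut c.G) x * k ∈ Hv ((baseAct (outerSemidirectProductSnd ρ e)).hom.vertexMap w) := by
  have hmem := map_mem_verticialSubgroups_of_rep c ρ (hV _ w (Hv w) (hHv w)) e.1.1
    (mk_fst_eq_rho_snd ρ e)
  obtain ⟨k, hk⟩ := exists_conj_of_mem_verticialSubgroups c (hHv _) hmem
  exact ⟨k, mem_iff_of_map_eq_conj _ _ _ k hk⟩

/-- **Edge conjugators, first clause** (T1b `exists_isEConj` clause 1, unfolded, in the EXACT form):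
for every `e` and every edge `ε`, with `M_ε ∈ edgeLikeSubgroups c ε` chosen representatives, there is
`m ∈ π₁^temp(𝒢)` with `x ∈ M_ε ↔ m⁻¹ · φ_e(x) · m ∈ M_{(aug e)•ε}`, from the binder `hE` and "one
conjugacy class per edge". [cite: MochizukiSemiAnbd2006, §5, p. 65] -/
theorem exists_eConj_outerAction
    (hE : ∀ (a : PA) (ε : 𝒢.graph.Edge) (K : Subgroup c.G), K ∈ edgeLikeSubgroups c ε →
      ∃ φ : contMulAut c.G, TopOut.mk c.G φ = ρ a ∧
        K.map (φ : MulAut c.G).toMonoidHom ∈ edgeLikeSubgroups c ((baseAct a).hom.edgeMap ε))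
    (Me : 𝒢.graph.Edge → Subgroup c.G) (hMe : ∀ ε, Me ε ∈ edgeLikeSubgroups c ε)
    (e : outerSemidirectProduct ρ) (ε : 𝒢.graph.Edge) :
    ∃ m : c.G, ∀ x : c.G, x ∈ Me ε ↔
      m⁻¹ * (e.1.1 : MulAut c.G) x * m ∈ Me ((baseAct (outerSemidirectProductSnd ρ e)).hom.edgeMap ε) := by
  have hmem := map_mem_edgeLikeSubgroups_of_rep c ρ (hE _ ε (Me ε) (hMe ε)) e.1.1
    (mk_fst_eq_rho_snd ρ e)
  obtain ⟨m, hm⟩ := exists_conj_of_mem_edgeLikeSubgroups c (hMe _) hmem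
  exact ⟨m, mem_iff_of_map_eq_conj _ _ _ m hm⟩

/-- The `Aut`-component and the base action as the tower's pair `(Φ, σ)`: along `ι`, `Φ (ι g) = conj g`
and `σ (ι g) = 1` (the two laws abc-iut-L3-d4's `arithAct_eq_deckAct_of_inner` / `le_comap_levelKer`
consume). [cite: MochizukiSemiAnbd2006, Prop 5.2 (iv), p. 64] -/
theorem outerAction_inner_laws (g : c.G) :
    ((toOuterSemidirectProduct ρ g).1.1 : MulAut c.G) = MulAut.conj g ∧
      baseAct (outerSemidirectProductSnd ρ (toOuterSemidirectProduct ρ g)) = 1 := by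
  refine ⟨rfl, ?_⟩
  rw [outerSemidirectProductSnd_toOuterSemidirectProduct, map_one]

end ProfiniteSemiGraph

end Literature.AnabelianGeometry.SemiGraphs
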